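import Summits.Parity.GeneralizedHardyLittlewood.Theses.LiouvilleShiftedTables
import Summits.Parity.GeneralizedHardyLittlewood.Theorems.TypeI2Dilated.Negative.LogPowerBias
import Literature.NumberTheory.Sieve.BombieriFriedlanderIwaniecDispersion

/-!
# Line `q-joins-r` — skeleton for crux `LiouvilleShiftedTables.TypeI2Dilated`
# (stmt-Parity-14272, route-Parity-LiouvilleShiftedTables, rank 4)

**Idea (lever M, cards `q-joins-r` ≈ `crt-residue-modulus-side`, merged by the triage panel).**
The dilation modulus `q ≤ x^ρ` of the crux is a SECOND ROUGH MODULUS: it is carried through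
Linnik's dispersion in the slot of BFI's `r`, the residue being fixed in CRT coordinates
`(a₁ ā₂ mod rs ; v mod q)`.  At the zero frequency the extra congruence `n₁ ≡ n₂ (mod q)` is of the
same kind as `r`'s and is paid by Siegel–Walfisz (`q ≤ ℒ^B`) plus the large sieve over the FAMILY of
classes `mod q·r·(s₁,s₂)` (Bombieri–Vinogradov division of labour; BFI Theorem 0 (a), PROVED in the
tree); off the diagonal the one new Kloosterman phase `e(h v \overline{n₁ q₀ q₁ q₂ r}/q)` depends on
the smooth variables only through their classes `mod q` and is Drappeau's congruence-conditioned
Kuznetsov bound (PLMS 2017 = arXiv:1504.05549, Thm 2.1, loss `q^{3/2+ε} = x^{O(ρ)}`, affordable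
because `ρ` is existential and the off-diagonal saving is a power of `x`).

**The four stubs and the glue.**

* `stub_dilatedDispersion : DilatedDispersion` — THE LEVER (hardest): BFI 1986 Theorem 6 in `𝒟`-form
  (absolute values over the rough modulus `r`, the smooth modulus `s` summed over an interval inside
  `(S, 2S]` = weights (A₇)), DILATED: `∑_{q ∼ P}` outside with a unit-class selector `v q`, coprime core
  `(r, q) = (s, q) = 1` (the triage repair of the card's `DilatedDispG`: no CRT-incompatible bias), the
  expected term `φ(rsq)⁻¹ ∑_{(mn, rsq) = 1}` (one unit class `mod r s q`), a rational residue
  `a₂ · mn ≡ a₁ (mod rs)` with `|a₂| ≤ x^{ρ₀}` chosen after `x` (the de-dilated non-unit classes, in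
  particular the glue's class `w ≡ −c`, have residue `c · ḡ`, `g ∣ q` — cdisprove `typeI2Dilated_glue_slice`),
  the product cut `u < mn ≤ w` (FT's `Δ^{u,v}`), Siegel–Walfisz (A₂) for every interval restriction of `β`
  (the class §16 of BFI and FT actually use; tree `BombieriFriedlanderIwaniecTheorem6.intervalForm`),
  sifting (A₄), `α` arbitrary; ranges `x^ε R < N < x^{−ε}(x/R)^{1/3}`, `R, P ≤ x^{ρ₀}` and the standing
  assumption (13.1) WITH SLACK `S² R ≤ x^{1+ρ₀}` (the crux's level `S R ≤ x^{1/2+ρ}` gives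
  `S² R ≤ x^{1+2ρ}` for free, so NO Dirichlet switch is needed; the slack, like every `q`- and `a₂`-loss,
  is a factor `x^{O(ρ₀)}` paid from the window's `x^ε`).  Its `P = 1/2, a₂ = 1, u = 0, w = ∞` slice is
  BFI Theorem 6 in the case (13.1) (`BombieriFriedlanderIwaniecTheorem6.core`).
* `stub_smoothVariablesInAP : SmoothVariablesInAP` — IN PRINT: Fouvry–Tenenbaum 2021 Lemmas 4.11, 4.12,
  4.13 (one, two, three `Y₀`-sifted smooth variables in classes `mod D` with the weight `g_d(·; a)`,
  levels `x^{1−ε}, x^{2/3−ε}, x^{21/41−ε}`, loss `D^{C₀}`; Weil / Deligne–Heath-Brown `d₃`), with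
  `D :=` the dilation modulus.  Polynomial losses in `D = q ≤ x^ρ` are affordable (power savings).
* `stub_sieveAssembly : DilatedDispersion → SmoothVariablesInAP → CoreLambda` — FT §5 (proof of
  Prop. 5.1) for `f = λ`, dilated: from the two analytic inputs to the `λ`-level statement `CoreLambda`
  (constant rational class `G·k ≡ W (mod q)`, ANY class, no coprimality between `rs` and `q`; residue
  `k ≡ a₁ (mod rs)` with `(r, a₁) = 1`, `(s, F) = 1`, `a₁ ∣ F`).  Sparse/exceptional sets are removed at
  the constant-class level (`#{q : q ∣ Gk − W} ≤ τ(|Gk − W|)`); per bilinear piece the `q`-part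
  `u₁ = (rs, q^∞)` of the modulus moves into the dilation modulus `lcm(q, u₁)` (power tail cut, Rankin)
  and the non-unit part `g = (class, modulus)` is de-dilated inside the bilinear form (`m = g_m m'`,
  `n = g_n n'`, `a₂ := g`) — both land in `DilatedDispersion`'s selector / rational-residue slots.
* `stub_coreReduction : CoreLambda → TypeI2DilatedSel` — elementary: `k`-coordinates (`k = rsn + c ≤ y + c`
  runs over the progression `c mod rs`; the class `rsn ≡ w (q)` is `k ≡ w + c (q)`), dyadic decomposition
  of `q, r, s, k`, small `k` trivially, the `c`-parts `(r_c, s_c)` of `r, s` (tails `∑_{t ∣ c^∞, t > T} 1/t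
  ≪_c T^{−1/2}`, `T = ℒ^{O(A)}`), `a₁ := c/(r_c s_c, c)`, `G := (r_c s_c, c)`, the `c`-smooth cofactor
  riding with `r` (hence only `(r, a₁) = 1` on the rough modulus).  `TypeI2DilatedSel` is the crux with a
  class SELECTOR `w q` per dilation modulus (stronger); the glue instantiates the constant selector.
* `TypeI2Dilated_of : TypeI2Dilated` — sorry-free composition, concludes the crux BY NAME.

**Disproof used** (cdisprove `Disproof.lean` v1–v3 and gen-2 v1–v2 on stmt-Parity-14272, read through the
item notes — the evidence store is not mounted in this seat; landed and IMPORTED here: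
`Theorems/TypeI2Dilated/Negative/LogPowerBias.lean`): `not_typeI2DilatedFor_of_logPowerBias` /
`not_typeI2DilatedFor_of_periodic/_chi4/_biasedClass` — any proof must contain Siegel–Walfisz-strength
input and beat characters of every conductor `≤ x^ρ` with log-power savings: H = Siegel–Walfisz enters as
hypothesis (A₂) of `stub_dilatedDispersion` (discharged in `stub_sieveAssembly` by the tree's PROVED
`SiegelWalfiszMoebius_holds` for the `μ/λ`-pieces) and, inside `stub_dilatedDispersion`, at the zero
frequency (Theorem 0 (a) at moduli `q·k`: SW below `ℒ^B`, multiplicative large sieve above) — the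
characters of conductor in `(ℒ^B, x^ρ]` are exactly what the `ℓ¹` family average pays for;
`not_typeI2DilatedFreeY_of_unbounded` (`y ≤ x` load-bearing) — used in `stub_coreReduction` (heights
`K ≤ x`); `c ≠ 0` (not load-bearing for truth, but for the METHOD: BFI's `a ≠ 0`) — `a₁ ∣ c`, `a₁ ≠ 0` in
`stub_dilatedDispersion`; `not_typeI2DilatedUniformC` — every statement here is `∀ A ∃ C`;
`typeI2Dilated_glue_slice` / `inner_w0_undilate` — the rational residue `a₁ ā₂` of the stubs is that
slice's `c·q̄`.  No stub is an instance of the landed Negative lemmas (they refute the crux SHAPE for biased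
`f`; `not_logPowerBias_liouville` is PROVED for `λ`).  Negatives index 4218 / 9541 / 14832: no contact.
-/

noncomputable section

namespace Summit.Parity.GeneralizedHardyLittlewood.Cruxes.TypeI2Dilated.QJoinsR

open scoped BigOperators Topology Manifold Classical MeasureTheory ProbabilityTheory Matrix InnerProductSpace ComplexConjugate ContinuousMap
open Finset Real
open scoped ArithmeticFunction.sigma
open Literature.NumberTheory.Sieve Literature.NumberTheory.Sieve.BFI
open Summit.Parity.GeneralizedHardyLittlewood.Theses.LiouvilleShiftedTables (TypeI2Dilated)

/-! ## Objects of the line -/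

/-- **The dilated inner discrepancy** (B-normalisation, rational residue, product cut).  For the
dilation modulus `q` with class `v`, the dispersion modulus `d = r s`, the residue `a₁ ā₂ (mod d)` and
the cut `u < mn ≤ w`:
`∑_{m∼M, n∼N, u<mn≤w, a₂mn ≡ a₁ (d), mn ≡ v (q)} α_m β_n − φ(dq)⁻¹ ∑_{m∼M, n∼N, u<mn≤w, (mn, dq)=1} α_m β_n`.
Used only with `(d, q) = 1`, `(d, a₁a₂) = 1`, `(v, q) = 1`, when `{k : a₂k ≡ a₁ (d), k ≡ v (q)}` is ONE unit
class `mod dq` (so the subtracted mean is the CRT-consistent one — the triage repair of `DilatedDispG`). -/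
def dilDisc (a₁ a₂ v : ℤ) (M N u w : ℝ) (α β : ℕ → ℝ) (q d : ℕ) : ℝ :=
  (∑ m ∈ dyadic M, ∑ n ∈ dyadic N,
      if u < ((m * n : ℕ) : ℝ) ∧ ((m * n : ℕ) : ℝ) ≤ w ∧
          (a₂ : ZMod d) * ((m * n : ℕ) : ZMod d) = (a₁ : ZMod d) ∧
          ((m * n : ℕ) : ZMod q) = (v : ZMod q)
      then α m * β n else 0) -
    (∑ m ∈ dyadic M, ∑ n ∈ dyadic N,
      if u < ((m * n : ℕ) : ℝ) ∧ ((m * n : ℕ) : ℝ) ≤ w ∧ (m * n).Coprime (d * q)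
      then α m * β n else 0) / (Nat.totient (d * q) : ℝ)

/-- **Statement of stub 1 (the lever): BFI 1986 Theorem 6, `𝒟`-form, DILATED — "`q` joins `r`".**
For `a₁ ≠ 0`, `F ≠ 0` with `a₁ ∣ F`, `ε, A > 0`, a divisor exponent `B ≥ 0` and Siegel–Walfisz constants
`Csw` there are `ρ₀ > 0`, `B₀`, `C`, `x₀` such that for `x ≥ x₀`, all `MN = x` with `x^ε ≤ N ≤ x^{1−ε}`
(A₁), `S, R, P ≥ 1/2`, `S < S₁ ≤ 2S` (A₇), `R ≤ x^{ρ₀}`, `P ≤ x^{ρ₀}`, (13.1) with slack `S²R ≤ x^{1+ρ₀}`,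
the Theorem-6 window `x^ε R < N < x^{−ε}(x/R)^{1/3}`, every real `β` with (A₂) on EVERY interval
restriction and (A₄) (`β_n = 0` if `n ∼ N` has a prime factor `≤ ℒ^{B₀}`), every real `α`, every rational
denominator `a₂ ≠ 0`, `|a₂| ≤ x^{ρ₀}`, every class selector `v`, and every product cut `u, w`:
`∑_{q∼P, (q, v q)=1} ∑_{r∼R, (r,q)=1, (r,a₁a₂)=1} |∑_{s∼S, s≤S₁, (s,q)=1, (s,a₂F)=1} dilDisc a₁ a₂ (v q) M N u w α β q (rs)|
 ≤ C ‖α‖ ‖β‖ x^{1/2} ℒ^{−A}`.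
Trivial size of the left side is `≍ ‖α‖‖β‖ x^{1/2} ℒ^{O(1)}` (the `ℓ¹`-family over `q ∼ P` carries the
density `1/q` per class); the `P = 1/2` (`q = 1`), `a₂ = 1`, `u = 0 ≤ w = ∞` slice is
`BombieriFriedlanderIwaniecTheorem6.core` (signs `δ_r`, weights `a7Weight S₁`).  Plan of proof: BFI §3
(smoothing of the `s`-interval, Lemma 3 = Shiu), §§4–6 (`S₃, S₂, S₁`, Poisson in `m`, with the CRT
residue: the `q`-coordinate contributes the phase `e(h (v q) \overline{n₁ q₀ s₁ s₂ r}/q)` and `a₂` joins the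
inverted variables), §7 (main terms: Theorem 0 (a) at moduli `q·k ≤ x^{2ρ₀}ℒ^{B₁} ≪ N ℒ^{−2A−4}` — its
PROVED range — SW below `ℒ^B`, large sieve above: the ONLY `(log)`-currency step, and the only place the
family sum over `q` is consumed), §13 (`ℛ₁` via Drappeau 2017 Thm 2.1 — Kuznetsov with `c ≡ c₀, d ≡ d₀
(mod q)` on the smooth variables, loss `(qCDNRS)^ε q^{3/2}` — in place of Deshouillers–Iwaniec Thm 12 =
BFI Lemma 1, after splitting `β` into classes `mod q` inside `ℛ₁` only, cost `√q`); all `q`-, `a₂`- and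
slack-losses are `x^{O(ρ₀)}` against the conditions `N³R < x^{1−ε}`, `N^{3/2} S R < x^{1−ε}`.
[cite: BombieriFriedlanderIwaniecActa1986 §§3–7, §13 Thm 6, (13.1)–(13.4); Drappeau2017 = arXiv:1504.05549
Thm 2.1 and §2; FouvryTenenbaum2021 Lemma 4.7] -/
def DilatedDispersion : Prop :=
  ∀ a₁ F : ℤ, a₁ ≠ 0 → F ≠ 0 → a₁ ∣ F →
  ∀ ε : ℝ, 0 < ε → ∀ A : ℝ, 0 < A → ∀ B : ℝ, 0 ≤ B → ∀ Csw : ℝ → ℝ,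
    ∃ ρ₀ B₀ C x₀ : ℝ, 0 < ρ₀ ∧ ∀ x : ℝ, x₀ ≤ x → ∀ M N S R P S₁ u w : ℝ,
      M * N = x → x ^ ε ≤ N → N ≤ x ^ (1 - ε) →
      1 / 2 ≤ S → 1 / 2 ≤ R → 1 / 2 ≤ P → S < S₁ → S₁ ≤ 2 * S →
      R ≤ x ^ ρ₀ → P ≤ x ^ ρ₀ → S ^ 2 * R ≤ x ^ (1 + ρ₀) →
      x ^ ε * R < N → N < x ^ (-ε) * (x / R) ^ (1 / 3 : ℝ) →
      ∀ β : ℕ → ℝ,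
        (∀ N₁ N₂ : ℝ,
          SiegelWalfiszHyp N B Csw (fun n => if N₁ < (n : ℝ) ∧ (n : ℝ) ≤ N₂ then β n else 0)) →
        IsSifted (dyadic N) (Real.log x ^ B₀) β →
      ∀ α : ℕ → ℝ, ∀ a₂ : ℤ, a₂ ≠ 0 → (|a₂| : ℝ) ≤ x ^ ρ₀ → ∀ v : ℕ → ℤ,
        (∑ q ∈ (dyadic P).filter (fun q : ℕ => IsCoprime (q : ℤ) (v q)),
          ∑ r ∈ (dyadic R).filter (fun r : ℕ => r.Coprime q ∧ IsCoprime (r : ℤ) (a₁ * a₂)),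
            |∑ s ∈ (dyadic S).filter
                (fun s : ℕ => (s : ℝ) ≤ S₁ ∧ s.Coprime q ∧ IsCoprime (s : ℤ) (a₂ * F)),
              dilDisc a₁ a₂ (v q) M N u w α β q (r * s)|) ≤
          C * Real.sqrt (l2Sq M α) * Real.sqrt (l2Sq N β) * x ^ (1 / 2 : ℝ) / Real.log x ^ A

/-- Fouvry–Tenenbaum's weight `g_d(n; a) = 1_{n ≡ a (mod d)} − φ(d)⁻¹ 1_{(n, d) = 1}` (§1.1, PDF p. 6:
"`∆_f(x; q, a) = ∑_{n ≤ x} f(n) g_q(n; a)`"), for a residue `a` coprime to `d`.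
[cite: FouvryTenenbaum2021, §1.1] -/
def apWeight (d : ℕ) (a : ZMod d) (n : ℕ) : ℝ :=
  (if (n : ZMod d) = a then 1 else 0) - (if n.Coprime d then 1 else 0) / (Nat.totient d : ℝ)

/-- **Fouvry–Tenenbaum 2021, Lemma 4.11** (PDF p. 19; `τ₁` in progressions, level `x^{1−ε}`, slightly
sifted variable — trivial for `Y₀ = 2`, fundamental lemma otherwise): "For each `ε > 0`, suitable
`δ = δ(ε), c(ε) > 0`, and uniformly for `x ≥ 1`, `M ≥ 1`, `Y₀ ≥ 2`, and integers `a, q, t, D` such that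
`2 ≤ Y₀ < x^{1/100} < M ≤ x`, `1 ≤ q ≤ x^{1−ε}`, `(q, aD) = 1`, `(t, D) = 1`, we have …
`∑_{m ≃ M, m ≡ t (mod D)} g_q(m; a) 𝟙_{Y₀}(m) ≪ D^{C₀} x^{1−c(ε)/log Y₀}/φ(q)`" (`C₀` absolute; `m ≃ M`
= `m` in some interval inside `(M, 2M]`; `𝟙_{Y₀}` = indicator of `P⁻(m) ≥ Y₀` = `BFI.roughIndicator Y₀`).
The AP modulus is called `d` here (`q` is our dilation modulus, which plays FT's `D`).
[cite: FouvryTenenbaum2021, Lemma 4.11] -/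
def FTLemma411 : Prop :=
  ∃ C₀ : ℝ, ∀ ε : ℝ, 0 < ε → ∃ c C : ℝ, 0 < c ∧ ∀ x : ℝ, 1 ≤ x → ∀ Y₀ M L U : ℝ,
    2 ≤ Y₀ → Y₀ < x ^ (1 / 100 : ℝ) → x ^ (1 / 100 : ℝ) < M → M ≤ x →
    ∀ d D : ℕ, 1 ≤ d → (d : ℝ) ≤ x ^ (1 - ε) → 1 ≤ D → d.Coprime D →
    ∀ a : ZMod d, IsUnit a → ∀ t : ZMod D, IsUnit t →
      |∑ m ∈ (dyadic M).filter (fun m : ℕ => L < (m : ℝ) ∧ (m : ℝ) ≤ U ∧ (m : ZMod D) = t),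
          apWeight d a m * roughIndicator Y₀ m| ≤
        C * (D : ℝ) ^ C₀ * x ^ (1 - c / Real.log Y₀) / (Nat.totient d : ℝ)

/-- **Fouvry–Tenenbaum 2021, Lemma 4.12** (PDF p. 19; `τ₂` in progressions to level `x^{2/3−ε}`, Weil's
bound, classes `mod D` on both variables by additive characters `mod D`, loss `D^{C₀}`): "uniformly for
`x ≥ 1`, `M₁, M₂ ≥ 1`, `Y₀ ≥ 2`, and integers `a, q, t₁, t₂, D` such that `2 ≤ Y₀ ≤ x^{1/100} ≤ M₁ ≤ M₂`,
`M₁M₂ ≤ x`, `1 ≤ q ≤ x^{2/3−ε}`, `(q, aD) = 1`, `(t₁t₂, D) = 1`, we have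
`∑_{m₁ ≃ M₁, m₂ ≃ M₂, mᵢ ≡ tᵢ (mod D)} g_q(m₁m₂; a) 𝟙_{Y₀}(m₁m₂) ≪ D^{C₀} x^{1−c(ε)/log Y₀}/φ(q)`".
[cite: FouvryTenenbaum2021, Lemma 4.12] -/
def FTLemma412 : Prop :=
  ∃ C₀ : ℝ, ∀ ε : ℝ, 0 < ε → ∃ c C : ℝ, 0 < c ∧ ∀ x : ℝ, 1 ≤ x →
    ∀ Y₀ M₁ M₂ L₁ U₁ L₂ U₂ : ℝ,
    2 ≤ Y₀ → Y₀ ≤ x ^ (1 / 100 : ℝ) → x ^ (1 / 100 : ℝ) ≤ M₁ → M₁ ≤ M₂ → M₁ * M₂ ≤ x →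
    ∀ d D : ℕ, 1 ≤ d → (d : ℝ) ≤ x ^ (2 / 3 - ε) → 1 ≤ D → d.Coprime D →
    ∀ a : ZMod d, IsUnit a → ∀ t₁ t₂ : ZMod D, IsUnit t₁ → IsUnit t₂ →
      |∑ m₁ ∈ (dyadic M₁).filter (fun m : ℕ => L₁ < (m : ℝ) ∧ (m : ℝ) ≤ U₁ ∧ (m : ZMod D) = t₁),
        ∑ m₂ ∈ (dyadic M₂).filter (fun m : ℕ => L₂ < (m : ℝ) ∧ (m : ℝ) ≤ U₂ ∧ (m : ZMod D) = t₂),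
          apWeight d a (m₁ * m₂) * roughIndicator Y₀ (m₁ * m₂)| ≤
        C * (D : ℝ) ^ C₀ * x ^ (1 - c / Real.log Y₀) / (Nat.totient d : ℝ)

/-- **Fouvry–Tenenbaum 2021, Lemma 4.13** (PDF p. 19; `τ₃` in progressions to level `x^{21/41−ε}`,
Heath-Brown's `d₃` theorem [16, th. 1] via Deligne's bounds, classes `mod D` on the three variables, loss
`D^{C₀}`): "uniformly for `x ≥ 1`, `M₁, M₂, M₃ ≥ 1`, `Y₀ ≥ 2`, and integers `a, q, t₁, t₂, t₃, D` such that
`2 ≤ Y₀ ≤ x^{1/100} ≤ M₁ ≤ M₂ ≤ M₃`, `M₁M₂M₃ ≤ x`, `1 ≤ q ≤ x^{21/41−ε}`, `(q, aD) = 1`, `(t₁t₂t₃, D) = 1`,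
we have `∑_{mᵢ ≃ Mᵢ, mᵢ ≡ tᵢ (mod D)} g_q(m₁m₂m₃; a) 𝟙_{Y₀}(m₁m₂m₃) ≪ D^{C₀} x^{1−c(ε)/log Y₀}/φ(q)`".
The crux needs the level only up to `x^{1/2+O(ρ)} < x^{21/41}`.
[cite: FouvryTenenbaum2021, Lemma 4.13; Heath-Brown, Acta Arith. 47 (1986)] -/
def FTLemma413 : Prop :=
  ∃ C₀ : ℝ, ∀ ε : ℝ, 0 < ε → ∃ c C : ℝ, 0 < c ∧ ∀ x : ℝ, 1 ≤ x →
    ∀ Y₀ M₁ M₂ M₃ L₁ U₁ L₂ U₂ L₃ U₃ : ℝ,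
    2 ≤ Y₀ → Y₀ ≤ x ^ (1 / 100 : ℝ) → x ^ (1 / 100 : ℝ) ≤ M₁ → M₁ ≤ M₂ → M₂ ≤ M₃ →
      M₁ * M₂ * M₃ ≤ x →
    ∀ d D : ℕ, 1 ≤ d → (d : ℝ) ≤ x ^ (21 / 41 - ε) → 1 ≤ D → d.Coprime D →
    ∀ a : ZMod d, IsUnit a → ∀ t₁ t₂ t₃ : ZMod D, IsUnit t₁ → IsUnit t₂ → IsUnit t₃ →
      |∑ m₁ ∈ (dyadic M₁).filter (fun m : ℕ => L₁ < (m : ℝ) ∧ (m : ℝ) ≤ U₁ ∧ (m : ZMod D) = t₁),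
        ∑ m₂ ∈ (dyadic M₂).filter (fun m : ℕ => L₂ < (m : ℝ) ∧ (m : ℝ) ≤ U₂ ∧ (m : ZMod D) = t₂),
          ∑ m₃ ∈ (dyadic M₃).filter (fun m : ℕ => L₃ < (m : ℝ) ∧ (m : ℝ) ≤ U₃ ∧ (m : ZMod D) = t₃),
            apWeight d a (m₁ * m₂ * m₃) * roughIndicator Y₀ (m₁ * m₂ * m₃)| ≤
        C * (D : ℝ) ^ C₀ * x ^ (1 - c / Real.log Y₀) / (Nat.totient d : ℝ)

/-- **Statement of stub 2: the Type-I₁/I₂/I₃ inputs** — Fouvry–Tenenbaum 2021, Lemmas 4.11, 4.12 and 4.13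
as printed (`D :=` the dilation modulus of the crux; all losses polynomial in `D ≤ x^ρ` against power
savings).  [cite: FouvryTenenbaum2021, §4.5] -/
def SmoothVariablesInAP : Prop :=
  FTLemma411 ∧ FTLemma412 ∧ FTLemma413

/-- **The `λ`-level core** (conclusion of stub 3, hypothesis of stub 4): the crux in progression
coordinates, dyadic in every variable, with a constant RATIONAL class and the residue coprime to the
dispersion modulus — and nothing more (no coprimality between `rs` and the dilation modulus `q`, no
restriction on the class).  For `a₁, G, F ≠ 0` with `a₁ ∣ F` there is `ρ₀ > 0` such that for every `A > 0`
there are `C, x₀` with, for `x ≥ x₀`, all `1 ≤ K ≤ x`, `K < K₁ ≤ 2K`, `S ≥ 1/2`, `S < S₁ ≤ 2S`,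
`R, P ≥ 1/2`, `R ≤ x^{ρ₀}`, `P ≤ x^{ρ₀}`, `S R ≤ x^{1/2+ρ₀}` and every integer `W`:
`∑_{q∼P} ∑_{r∼R, (r,a₁)=1} |∑_{s∼S, s≤S₁, (s,F)=1} ∑_{k∼K, k≤K₁, k ≡ a₁ (rs), Gk ≡ W (q)} λ(k)| ≤ C x ℒ^{−A}`
(trivial size `≍ K ℒ^{O(1)} + RSP`).  The `P = 1/2` slice is Fouvry–Tenenbaum's Theorem 1.5 for `f = λ`
(level `1/2 + ρ₀` only) minus the `φ⁻¹∑_{(k,rs)=1} λ` means (prime number theorem for `λ`). -/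
def CoreLambda : Prop :=
  ∀ a₁ G F : ℤ, a₁ ≠ 0 → G ≠ 0 → F ≠ 0 → a₁ ∣ F →
    ∃ ρ₀ : ℝ, 0 < ρ₀ ∧ ∀ A : ℝ, 0 < A → ∃ C x₀ : ℝ, ∀ x : ℝ, x₀ ≤ x →
    ∀ K K₁ S S₁ R P : ℝ,
      1 ≤ K → K ≤ x → K < K₁ → K₁ ≤ 2 * K →
      1 / 2 ≤ S → S < S₁ → S₁ ≤ 2 * S → 1 / 2 ≤ R → 1 / 2 ≤ P →
      R ≤ x ^ ρ₀ → P ≤ x ^ ρ₀ → S * R ≤ x ^ (1 / 2 + ρ₀) →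
    ∀ W : ℤ,
      (∑ q ∈ dyadic P, ∑ r ∈ (dyadic R).filter (fun r : ℕ => IsCoprime (r : ℤ) a₁),
        |∑ s ∈ (dyadic S).filter (fun s : ℕ => (s : ℝ) ≤ S₁ ∧ IsCoprime (s : ℤ) F),
          ∑ k ∈ (dyadic K).filter (fun k : ℕ => (k : ℝ) ≤ K₁ ∧
              ((k : ℕ) : ZMod (r * s)) = (a₁ : ZMod (r * s)) ∧
              (G : ZMod q) * ((k : ℕ) : ZMod q) = (W : ZMod q)),
            (ArithmeticFunction.liouville k : ℝ)|) ≤ C * x / Real.log x ^ A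

/-- **The crux with a class selector** (conclusion of stub 4): verbatim the body of
`LiouvilleShiftedTables.TypeI2Dilated` except that the class `w` may depend on the dilation modulus
(`w : ℕ → ℕ`, `r s n ≡ w q (mod q)`).  STRONGER than the crux (which is the constant selector); it is the
form the proof delivers (after Cauchy–Schwarz / the large sieve every modulus has its own class) and the
form the elementary reductions need (several classes per modulus are bounded by the selector form and
Cauchy–Schwarz against the trivial bound). -/
def TypeI2DilatedSel : Prop :=
  ∀ c : ℤ, c ≠ 0 → ∃ ρ : ℝ, 0 < ρ ∧ ∀ A : ℝ, 0 < A → ∃ C x₀ : ℝ, ∀ x : ℝ, x₀ ≤ x → ∀ w : ℕ → ℕ,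
    ∀ R S y : ℝ, 1 ≤ R → R ≤ x ^ ρ → 0 ≤ S → S * R ≤ x ^ (1 / 2 + ρ) → 0 ≤ y → y ≤ x →
      (∑ q ∈ Finset.Icc 1 ⌊x ^ ρ⌋₊, ∑ r ∈ Finset.Icc 1 ⌊R⌋₊, |∑ s ∈ Finset.Icc 1 ⌊S⌋₊,
        ∑ n ∈ (Finset.Icc 1 ⌊y / (s * r)⌋₊).filter (fun n : ℕ => r * s * n ≡ w q [MOD q]),
          (ArithmeticFunction.liouville (Int.toNat ((r : ℤ) * s * n + c)) : ℝ)|) ≤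
        C * x / Real.log x ^ A

/-! ## The four stubs -/

/-- **Stub 1 — the dilated dispersion theorem (the lever; hardest).**  See `DilatedDispersion`.
Why plausibly true: its undilated slice is BFI Theorem 6 in the case the printed proof establishes; the
dilation `q`, the denominator `a₂` and the (13.1)-slack cost `x^{O(ρ₀)}` in the Kloosterman stage (power
saving, `ρ₀` chosen after `ε`) and nothing at the zero frequency beyond replacing "(A₂) for `k ≤ ℒ^{B₁}`"
by Theorem 0 (a) over the family of moduli `q·k` (proved in the tree, inside its range since
`q ≤ x^{ρ₀} ≪ N ℒ^{−2A−4}`); the one new analytic input is Drappeau 2017 Thm 2.1 (in print, to vendor).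
Why it might fail: after Poisson the `q`-phase involves `n̄₁ (mod q)` with `n₁` a `β`-variable (not
smooth), so `β` must be split into classes `mod q` inside `ℛ₁` (cost `√q`, affordable); if a non-smooth
variable stays coupled to `q` in a way Thm 2.1's `(c₀, d₀)` cannot encode, the power saving is lost.
Size: L+ (BFI §§3–7, 13 re-run with one more CRT coordinate; tree anatomy `…DispersionSmoothing/S3/S2/S1/
MainTerm`, `…Theorem6Core` lists what is proved). -/
theorem stub_dilatedDispersion : DilatedDispersion := by
  sorry

/-- **Stub 2 — smooth variables in progressions with classes (Fouvry–Tenenbaum 2021, Lemmas 4.11–4.13,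
as printed).**  See `SmoothVariablesInAP`.  Why true: printed theorems (Weil; Friedlander–Iwaniec /
Heath-Brown `d₃` with Deligne; fundamental lemma for the `Y₀`-sifting; additive characters `mod D` for
the classes, "with no loss up to the factor `D^{C₀}`", PDF p. 20).  Size: M as a vendoring task (three
named facts `FouvryTenenbaum2021_lemma411/412/413` in `Literature/NumberTheory/Sieve/`, then
`⟨h₁, h₂, h₃⟩`); proving them is far beyond (Deligne). -/
theorem stub_smoothVariablesInAP : SmoothVariablesInAP := by
  sorry

/-- **Stub 3 — the sieve assembly (Fouvry–Tenenbaum §5 for `f = λ`, dilated).**  From the Type-II input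
(`DilatedDispersion`) and the Type-I₁₂₃ input (`SmoothVariablesInAP`) to `CoreLambda`.  Plan (FT PDF
pp. 22–27 with `f = λ ∈ 𝓕(1,1)`, every `D`-class replaced by the dilation class): on `k ∼ K` factor
`k = ν · h`, `ν` the `Y₀ = exp(ℒ^{1/4})`-smooth part, and group the SMALLEST primes of `h` greedily into a
block `n` until it first exceeds `x^{η}` (`η ≫ ρ`): either `n ∈ (x^η, x^{2η}]`, or the block is `< x^η`
and the next prime `p ≤ x^{1/3−η'}` is the Type-II variable, or `≤ 3` primes `> x^{1/3−η'}` remain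
(Type I₁₂₃ after `1_ℙ ↦ Λ ↦` Heath-Brown's identity, FT Lemma 4.5; tree `heathBrown_identity`) — so NO
Type-II piece has `N < x^{ε}RP` and Fouvry–Radziwiłł (FT Lemma 4.8) is not needed at level `1/2 + O(ρ)`
(fallback if a prover keeps FT's smallest-prime split: a dilated Lemma 4.8 would be one more input);
remove the exceptional sets (`ν > Z₀`, square factors among the large primes, two close primes
`p_j < p_{j+1} ≤ ϱ p_j`, `ϱ = 1 + ℒ^{−B₀}`) at the CONSTANT class `Gk ≡ W (q)` by FT Lemma 4.2-type bounds
(`#{q ∼ P : q ∣ Gk − W} ≤ τ(|Gk − W|)`, Shiu = tree `Shiu1980BrunTitchmarsh` / `shiu_uniform`); for each bilinear piece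
(`β` = products of primes in boxes: interval-SW by the Siegel–Walfisz theorem for `μ/λ`-type pieces, tree
`SiegelWalfiszMoebius_holds`, (A₂)-production as in tree `siegelWalfiszHyp_of_dense`; sifted trivially) (i) strip `u₁ = (rs, q^∞)` from the dispersion modulus
into the dilation modulus `lcm(q, u₁) ≤ x^{4ρ}` (power tail `u₁ > x^{3ρ}` by Rankin:
`≪ x^{1+ρ+o(1)−3ρ/2}`), (ii) de-dilate the non-unit part `g = (class, lcm(q,u₁))` INSIDE the bilinear form
(`m = g_m m'`, `n = g_n n'`, `a₂ := g`; the sum over `g` costs `∑_d ‖α 1_{d∣·}‖/√d ≤ ℒ^{O(1)}` times the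
`τ`-weighted `ℓ²`-norms, fine for divisor-bounded pieces), (iii) collect the resulting unit classes
`mod q̂ = lcm(q,u₁)/g` in `DilatedDispersion`'s selector (several classes per `q̂`, multiplicity
`≤ τ(q̂g)²`: Cauchy–Schwarz against the trivial bound; note `(s', q̂) = 1 ∧ (s', a₂) = 1 ⇔ (s', q) = 1`,
which is why the stub's `s`-filter reads `(s, q) = 1 ∧ (s, a₂F) = 1`); Type I: FT Lemmas 4.11/4.12/4.13
with `D := q` (the product class split into `≤ q³` tuples of unit classes, `ν` and the tiny block joining
the residue `a ν̄`; levels `1 − ε, 2/3 − ε, 21/41 − ε > 1/2 + 3ρ`); the `φ⁻¹∑_{(k, rsq)=1} λ` means by the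
prime number theorem for `λ` with coprimality (tree `SiegelWalfiszMoebius_holds.liouville_progression`).
Why it might fail: size, not substance — the one step without a printed model is (iii) (checked on
paper: multiplicities divisor-bounded, classes per modulus handled by the selector + Cauchy–Schwarz).
Size: L (FT §5 is 6 pp. of combinatorics on top of 10 pp. of lemmas; Lean cost dominated by finset
manipulations). -/
theorem stub_sieveAssembly : DilatedDispersion → SmoothVariablesInAP → CoreLambda := by
  sorry

/-- **Stub 4 — the elementary reduction of the crux to the core.**  `CoreLambda → TypeI2DilatedSel`:
(1) `k := r s n + c` runs over `c < k ≤ y + c`, `k ≡ c (mod rs)`, and `rsn ≡ w (q)` iff `k ≡ w + c (q)`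
(`Int.toNat` junk only for `k ≤ 0`, where `λ 0 = 0`); (2) dyadic decomposition of `q ≤ x^ρ`, `r ≤ R`,
`s ≤ S`, `k ≤ y + c` (`≪ ℒ⁴` blocks, interval ends `S₁, K₁`; outer blocks by monotonicity); (3) blocks with
`K ≤ xℒ^{−A−5}` trivially (`∑_{q,r,s} (K/(rsq) + 1) ≪ Kℒ³ + x^{1/2+2ρ}`); (4) the `c`-parts `r_c = (r, c^∞)`,
`s_c = (s, c^∞)`: tails `r_c s_c > ℒ^{2A+10}` by `∑_{t ∣ c^∞, t > T} τ(t)/t ≪_c T^{−1/2}`, and for each of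
the `O_c(log² ℒ)` remaining pairs `g' := (r_c s_c, c)`, `a₁ := c/g'`, `G := g'`, `W := w + c`, `F := c`, the
`c`-smooth cofactor `t' := r_c s_c/g'` riding with the rough modulus (`r ↦ t' r'`, a sub-family of a dyadic
range — the `r`-sum is an `ℓ¹`-sum of nonnegative terms, and `(t' r', a₁) = 1`), `λ(k) = λ(g') λ(k/g')`;
(5) `ρ := min ρ₀/3` over the finitely many `a₁ ∣ c`, constants added up (`y ≤ x` is used here: heights
`K ≤ x`).  Why it might fail: it does not (elementary), but it is where the coprimality normalisations the
triage flagged live, so it is filed as a stub and not waved through.  Size: M on paper, L in Lean. -/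
theorem stub_coreReduction : CoreLambda → TypeI2DilatedSel := by
  sorry

/-! ## Glue (sorry-free): the crux by name -/

/-- **The crux from the line.**  `TypeI2DilatedSel` (stub 4 ∘ stub 3 ∘ stubs 1, 2) with the constant
selector `fun _ => w` is `LiouvilleShiftedTables.TypeI2Dilated` verbatim.  Sorry-free; concludes the crux
BY NAME; the stubs are invoked, not assumed. -/
theorem TypeI2Dilated_of : TypeI2Dilated := by
  have hsel : TypeI2DilatedSel :=
    stub_coreReduction (stub_sieveAssembly stub_dilatedDispersion stub_smoothVariablesInAP)
  intro c hc
  obtain ⟨ρ, hρ, hA⟩ := hsel c hc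
  refine ⟨ρ, hρ, fun A hA' => ?_⟩
  obtain ⟨C, x₀, hx⟩ := hA A hA'
  exact ⟨C, x₀, fun x hx₀ w R S y h1 h2 h3 h4 h5 h6 =>
    hx x hx₀ (fun _ => w) R S y h1 h2 h3 h4 h5 h6⟩

/-- The crux is also the `λ`-instance of the disprover's generic shape (landed Negative file
`Theorems/TypeI2Dilated/Negative/LogPowerBias.lean`, imported above), so the skeleton is checked against
the very statement the negative lemmas `not_typeI2DilatedFor_of_logPowerBias` (refutes the SHAPE for
biased `f`) and `not_logPowerBias_liouville` (`λ` is not biased — Siegel–Walfisz, PROVED) speak about. -/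
example : Negative.TypeI2DilatedFor (fun n => (ArithmeticFunction.liouville n : ℝ)) :=
  Negative.typeI2Dilated_iff.mp TypeI2Dilated_of

end Summit.Parity.GeneralizedHardyLittlewood.Cruxes.TypeI2Dilated.QJoinsR

end
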